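import Mathlib
import Summits.Schanuel.Schanuel.Theses.LogPatterns
import Literature.NumberTheory.Transcendental.KirbyWeakSchanuelAx
import Literature.NumberTheory.Transcendental.GammaFieldsEcl
import Literature.Barriers.Schanuel.AxSchanuelFunctionalNotNumerical

/-!
# Birth skeleton (BC3) — crux `OffLogSector` (item stmt-Schanuel-4311) of route `LogPatterns`
# registrar `planner-skel-stmt-Schanuel-4311-0`, 2026-08-17

The crux (shared decl `Summit.Schanuel.Schanuel.Theses.LogPatterns.OffLogSector`, also wanted by
`MatrixCoefficients` and, as a BC2-redirect leaf of `RankLeTrdeg`, by `ExpMordellWeil`):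
Schanuel RELATIVE to the field of logarithms `K₀ = ℚ(𝓛)`, `𝓛 = exp⁻¹(ℚ̄) = {z | e^z ∈ ℚ̄}` —
for `x₁ … xₙ ∈ ℂ` that are `ℚ`-linearly independent modulo `span_ℚ 𝓛 (= 𝓛)`,
`trdeg_{K₀} K₀(x, eˣ) ≥ n`.

## The line: Kirby localisation one level down (regime removal by a THEOREM)

`𝓛 ⊆ E := ecl ∅` (Kirby's exponential-algebraic closure of `∅` in `ℂ_exp`: `e^z = α ∈ ℚ̄` makes `z`
a simple zero of the one-unknown Khovanskii system `p_α(e^z) = 0`; tree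
`GammaField.mem_ecl_of_exp_mem` + `Barriers.Schanuel.mem_ecl_of_isAlgebraic`), `E` is a countable
exp-closed subfield (`Khovanskii.eclSubfield`, `Khovanskii.exp_mem_ecl`, `ecl_empty_countable`), and
Kirby's relative Schanuel THEOREM (Bull. LMS 42 (2010) Thm 1.2 at `F = ℂ_exp`, `C = ecl ∅`; tree,
sorry-free from Ax 1971 Thm 3: `kirby_relative_schanuel_complex_holds`) settles the GENERIC regime —
tuples `ℚ`-independent modulo `E` — unconditionally, over the LARGER base `ℚ(E)`.  Two registered stubs:

* `stub_coreOffLog` (OPEN, the CORE regime; signature identical to the stub of the same name registered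
  from `Cruxes/RankLeTrdeg/Lines/OffLogSector_birth.lean`, so one proof serves both lines): tuples `y`
  FROM `E` that are `ℚ`-independent modulo `𝓛` have `trdeg_{K₀} K₀(y, e^y) ≥ |y|`.  Contains
  `e ∉ \overline{ℚ(𝓛)}` (`y = (1)`, `1 ∈ E`), hence `e ⊥ π`; every coordinate of `y` is a coordinate of a
  non-degenerate zero of a square exponential-polynomial system over `ℚ` (countably many tuples).
* `stub_relativeSectorSplit` (PROVABLE NOW, size L ≈ 150–200 lines; the RELATIVE twin of the tree's
  `Literature.NumberTheory.Transcendental.schanuel_of_sector_split_set` and of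
  `Theorems.RigidCore.sectorSplit`, Kirby 2010 Prop. 7.2 / §1 bookkeeping): for sets `S ⊆ T ⊆ ℂ` with
  `T` a `ℚ`-subspace closed under `exp`, the CORE hypothesis (tuples from `T` independent mod `span S`
  obey the relative bound over `ℚ(S)`) and the OUTSIDE hypothesis (tuples independent mod `span T` obey
  the relative bound over `ℚ(T)`) give the relative bound over `ℚ(S)` for EVERY tuple independent mod
  `span S`.  Proof: `V = span x`, `W = V ⊓ span T`, `U` a complement of `W` in `V`, bases `y ⊂ W`,
  `z ⊂ U` cleared of denominators (so `y, z, e^y, e^z ∈ K₀(x, eˣ)`); `k ≤ trdeg_{ℚ(S)} ℚ(S)(y, e^y)`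
  (core: `y ⊂ T`, `V ∩ span S = 0`); `m ≤ trdeg_{ℚ(T)} ℚ(T)(z, e^z) ≤ trdeg_{ℚ(S)(y,e^y)} ℚ(S)(y, e^y)(z, e^z)`
  (outside: `U ∩ span T = 0`; base change DOWN along `ℚ(S)(y, e^y) ≤ ℚ(T)`, which holds because
  `S ⊆ T`, `y ⊂ T`, `e^y ⊂ T`); tower law `k + m = n`; monotonicity along
  `ℚ(S)(y, z, e^y, e^z) ≤ ℚ(S)(x, eˣ)`.
* `OffLogSector_of` — composition (sorry-free): the split at `S = 𝓛`, `T = ecl ∅`, fed with the core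
  stub and Kirby's theorem BY NAME; the three closure side conditions are one-line tree facts.

Why this cut: it is the only exhaustive regime decomposition of the crux with a THEOREM on one side
(Kirby's Thm 1.2 needs an `ecl`-closed base and `ecl 𝓛 = ecl ∅` is the smallest one containing `𝓛`);
it localises every counterexample to the countable field `E` (Kirby's "essential counterexamples",
Prop. 7.2) while keeping the base `K₀`.  Neither stub gives the crux on its own (the core stub says
nothing about tuples meeting `ℂ ∖ E`, e.g. `x = (1, ξ)` with `ξ` exponentially transcendental; the
split is an implication with two open-ended hypotheses) and neither mentions Schanuel's absolute
statement — BC3 probes recorded in `Lines/birth.md`.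

Disproof used: none relevant — `ledger crux ls stmt-Schanuel-4311` shows no `Disproof.lean` at
registration; `ledger negatives --problem Schanuel` lists no statement of relative-Schanuel shape (the
core stub asserts a LOWER bound on a transcendence degree over `K₀`; no landed Negative lemma concerns
tuples from `ecl ∅` over `ℚ(𝓛)`).

Sources: Kirby2010EAEF = arXiv:0810.4285 (Thm 1.2, Lemma 3.3, Prop. 7.2); Ax 1971 Thm 3;
BaysKirby2018 = arXiv:1512.04262 §9–10; Waldschmidt2005 §1 (the sector 𝓛).
-/

noncomputable section

set_option linter.dupNamespace false

namespace Summit.Schanuel.Schanuel.Cruxes.OffLogSector.Birth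

open Summit.Schanuel.Schanuel.Theses.LogPatterns (OffLogSector)
open Literature.NumberTheory.Transcendental
  (ecl kirby_relative_schanuel_complex kirby_relative_schanuel_complex_holds)

/-! ## Registered stubs -/

/-- STUB 1 (OPEN; the core regime): `OffLogSector` ON KIRBY'S CORE `E = ecl ∅` — tuples from `E`
that are `ℚ`-linearly independent modulo `𝓛 = {z | e^z ∈ ℚ̄}` generate over `K₀ = ℚ(𝓛)`, together
with their exponentials, a field of transcendence degree `≥ |y|`.  Same signature as the registered
stub `stub_coreOffLog` of `Cruxes/RankLeTrdeg/Lines/OffLogSector_birth.lean`.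
[Kirby2010EAEF = arXiv:0810.4285, Thm 1.2 and Prop. 7.2; BaysKirby2018 §9] -/
theorem stub_coreOffLog :
    ∀ (k : ℕ) (y : Fin k → ℂ), (∀ i, y i ∈ ecl (∅ : Set ℂ)) →
      LinearIndependent ℚ ((Submodule.span ℚ {z : ℂ | IsAlgebraic ℚ (Complex.exp z)}).mkQ ∘ y) →
        (k : Cardinal) ≤
          Algebra.trdeg ↥(IntermediateField.adjoin ℚ {z : ℂ | IsAlgebraic ℚ (Complex.exp z)})
            ↥(IntermediateField.adjoin
              ↥(IntermediateField.adjoin ℚ {z : ℂ | IsAlgebraic ℚ (Complex.exp z)})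
              (Set.range y ∪ Set.range (Complex.exp ∘ y))) := by
  sorry

/-- STUB 2 (PROVABLE NOW, size L): the RELATIVE SECTOR SPLIT at a pair of sets `S ⊆ T ⊆ ℂ`, `T` a
`ℚ`-subspace closed under `exp` (Kirby's `GL_n(ℚ)` bookkeeping run over the base `ℚ(S)`; relative twin
of the tree's `schanuel_of_sector_split_set`): CORE (tuples from `T` independent modulo `span S`, bound
over `ℚ(S)`) and OUTSIDE (tuples independent modulo `span T`, bound over `ℚ(T)`) give the bound over
`ℚ(S)` for every tuple independent modulo `span S`.
[Kirby2010EAEF = arXiv:0810.4285, Prop. 7.2 and §1; tree `schanuel_of_sector_split_set`,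
`Summit.Schanuel.Schanuel.Theorems.RigidCore.sectorSplit` (absolute twins)] -/
theorem stub_relativeSectorSplit :
    ∀ (S T : Set ℂ), S ⊆ T → (∀ z ∈ Submodule.span ℚ T, z ∈ T) → (∀ z ∈ T, Complex.exp z ∈ T) →
      (∀ (k : ℕ) (y : Fin k → ℂ), (∀ i, y i ∈ T) →
        LinearIndependent ℚ ((Submodule.span ℚ S).mkQ ∘ y) →
          (k : Cardinal) ≤
            Algebra.trdeg ↥(IntermediateField.adjoin ℚ S)
              ↥(IntermediateField.adjoin ↥(IntermediateField.adjoin ℚ S)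
                (Set.range y ∪ Set.range (Complex.exp ∘ y)))) →
      (∀ (m : ℕ) (z : Fin m → ℂ), LinearIndependent ℚ ((Submodule.span ℚ T).mkQ ∘ z) →
          (m : Cardinal) ≤
            Algebra.trdeg ↥(IntermediateField.adjoin ℚ T)
              ↥(IntermediateField.adjoin ↥(IntermediateField.adjoin ℚ T)
                (Set.range z ∪ Set.range (Complex.exp ∘ z)))) →
      ∀ (n : ℕ) (x : Fin n → ℂ), LinearIndependent ℚ ((Submodule.span ℚ S).mkQ ∘ x) →
        (n : Cardinal) ≤
          Algebra.trdeg ↥(IntermediateField.adjoin ℚ S)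
            ↥(IntermediateField.adjoin ↥(IntermediateField.adjoin ℚ S)
              (Set.range x ∪ Set.range (Complex.exp ∘ x))) := by
  sorry

/-! ## Stub statements by name -/

namespace Statement

/-- Statement of `stub_coreOffLog`. -/
abbrev stub_coreOffLog : Prop := type_of% @Birth.stub_coreOffLog

/-- Statement of `stub_relativeSectorSplit`. -/
abbrev stub_relativeSectorSplit : Prop := type_of% @Birth.stub_relativeSectorSplit

end Statement

/-! ## Side conditions of the split at `S = 𝓛`, `T = ecl ∅` (one-line tree facts, sorry-free) -/

/-- `𝓛 ⊆ ecl ∅`: if `e^z` is algebraic then `e^z ∈ ecl ∅` (algebraic numbers are exponentially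
algebraic) and `ecl ∅` contains the logarithms of its members. [Kirby2010EAEF, Lemma 3.3 / §7] -/
theorem logSet_subset_ecl_empty :
    {z : ℂ | IsAlgebraic ℚ (Complex.exp z)} ⊆ ecl (∅ : Set ℂ) := fun _ hz =>
  Literature.NumberTheory.Transcendental.GammaField.mem_ecl_of_exp_mem
    (Literature.Barriers.Schanuel.mem_ecl_of_isAlgebraic (∅ : Set ℂ) hz)

/-- `ecl ∅` is a `ℚ`-subspace (it is a subfield of characteristic zero). [Kirby2010EAEF, Lemma 3.3] -/
theorem span_ecl_empty_subset :
    ∀ z ∈ Submodule.span ℚ (ecl (∅ : Set ℂ)), z ∈ ecl (∅ : Set ℂ) := fun _ hz =>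
  Literature.NumberTheory.Transcendental.GammaField.mem_span_ecl_iff.mp hz

/-- `ecl ∅` is closed under `exp`. [Kirby2010EAEF, Lemma 3.3] -/
theorem exp_mem_ecl_empty : ∀ z ∈ ecl (∅ : Set ℂ), Complex.exp z ∈ ecl (∅ : Set ℂ) := fun _ hz =>
  Literature.NumberTheory.Transcendental.Khovanskii.exp_mem_ecl hz

/-! ## Composition -/

/-- COMPOSITION (kernel-checked, no sorry; stub statements BY NAME): the relative sector split at
`S = 𝓛`, `T = ecl ∅`, fed with the core stub and Kirby's THEOREM
`kirby_relative_schanuel_complex_holds` (its statement is literally the OUTSIDE hypothesis at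
`T = ecl ∅`), is the crux `OffLogSector` by name. -/
theorem OffLogSector_of (h₁ : Statement.stub_coreOffLog)
    (h₂ : Statement.stub_relativeSectorSplit) :
    Summit.Schanuel.Schanuel.Theses.LogPatterns.OffLogSector :=
  fun n x hx =>
    h₂ {z : ℂ | IsAlgebraic ℚ (Complex.exp z)} (ecl (∅ : Set ℂ)) logSet_subset_ecl_empty
      span_ecl_empty_subset exp_mem_ecl_empty h₁ kirby_relative_schanuel_complex_holds n x hx

/-- The crux along this line MODULO exactly the two registered stubs (depends on `sorryAx` only
through `stub_*`). -/
theorem OffLogSector_proof : Summit.Schanuel.Schanuel.Theses.LogPatterns.OffLogSector :=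
  OffLogSector_of stub_coreOffLog stub_relativeSectorSplit

end Summit.Schanuel.Schanuel.Cruxes.OffLogSector.Birth

end
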